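import Summits.ABC.ABC.Theses.IneffectiveSubspace
import Summits.ABC.ABC.Theorems.IneffectiveSubspaceDepthCountedABCStubDictionary

/-!
# Certificates for line `Sketch` — crux `IneffectiveSubspace.DepthCountedABC` (stmt-ABC-14938), I: the dictionary

The skeleton `Cruxes/DepthCountedABC/Lines/Sketch.lean` (lead `prover-line-stmt-ABC-14938-0`) cuts the crux
into a T-part (small member at full size; at `K = 0` via the dictionary `LW4 → S4SmallMemberABC`) and a P-part
(all members power-rich).  This file records the LOGICAL POSITION of its core `stub_LW4` (card
`depth-grouped-four-logarithms`' C⁺) — it is an abc-type statement, not a strengthening in costume, and it is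
not refutable short of `¬ABC`:

* `lw4_of_s4SmallMember` — the converse dictionary `S4SmallMemberABC → LW4`; with the landed forward direction
  `stub_dictionary` this gives `lw4_iff_s4SmallMember : LW4 ↔ S4SmallMemberABC` (card item L1);
* `s4SmallMember_of_abc` — `ABC → S4SmallMemberABC` (card item L3), hence `lw4_of_abc : ABC → LW4`.

All statements are written fully unfolded (the skeleton's named `def`s live in a workfile and are not importable):
`LW4` = "for every `ε > 0` some `C > 0` with `C⁻¹ · H(x)^(−(1+ε)) ≤ |Σ_{j<4} (j+1) log x_j|` for all positive
`x : Fin 4 → ℚ` with nonzero form", `H(x) = ∏ |num x_j| · den x_j`; `S4SmallMemberABC` = "for every `ε > 0` some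
`C > 0` with `c ≤ C · a · (S₄(b) S₄(c))^(1+ε)` on abc triples", `S₄(n) = ∏ p ∈ n.primeFactors, p^((v_p(n)+3)/4)`.

Proofs.  Converse dictionary: for `x ∈ ℚ_{>0}⁴` put `q = ∏ x_j^(j+1) = N/D` reduced; `Λ(x) = log q ≠ 0` forces
`N ≠ D`, the triple `(|N − D|, min, max)` is abc, `S₄(N)·S₄(D) ≤ H(x)` because `N ∣ ∏ P_j^(j+1)`,
`D ∣ ∏ Q_j^(j+1)` and `⌈(Σ_j (j+1) v_j)/4⌉ ≤ Σ_j v_j`, and `|log q| ≥ |N − D| / max(N, D)` (`1 − t⁻¹ ≤ log t`).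
`ABC → S4SmallMemberABC`: `rad(abc) ≤ a · S₄(b) · S₄(c)` and `a^(ε/5) ≤ c^(ε/5) ≤ (S₄(b)S₄(c))^(4ε/5)` since
`n ≤ S₄(n)⁴`.

Sources: the skeleton and idea card `depth-grouped-four-logarithms` (items L1, L3); Mathlib only.  Companion file:
`IneffectiveSubspaceDepthCountedABCCertificatesCores.lean` (the two arithmetic cores are weakenings of the crux).
-/

-- `Summit.<Summit>.<Problem>` is the mandated summit-side namespace (CONVENTIONS §2); for the
-- single-conjunct summit `ABC` the two coincide, so the duplicate `ABC.ABC` is deliberate.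
set_option linter.dupNamespace false

namespace Summit.ABC.ABC.Theorems.DepthCountedABC

open scoped BigOperators
open UniqueFactorizationMonoid (radical)

/-! ## Arithmetic of the level-4 radical `S₄(n) = ∏_{p ∣ n} p^⌈v_p(n)/4⌉` -/

/-- `S₄(n)` is positive. [folklore] -/
theorem certificates_S4_pos (n : ℕ) : 0 < ∏ q ∈ n.primeFactors, q ^ ((n.factorization q + 3) / 4) :=
  Finset.prod_pos fun _ hq => pow_pos (Nat.prime_of_mem_primeFactors hq).pos _

/-- `n ∣ S₄(n)⁴` (as `v ≤ 4·⌈v/4⌉`), hence `n ≤ S₄(n)⁴` for `n ≠ 0`. [folklore] -/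
theorem certificates_le_S4_pow_four {n : ℕ} (hn : n ≠ 0) :
    n ≤ (∏ q ∈ n.primeFactors, q ^ ((n.factorization q + 3) / 4)) ^ 4 := by
  refine Nat.le_of_dvd (pow_pos (certificates_S4_pos n) 4) ?_
  rw [← Nat.factorization_le_iff_dvd hn (pow_ne_zero 4 (certificates_S4_pos n).ne')]
  intro p
  rw [Nat.factorization_pow, Finsupp.smul_apply, smul_eq_mul, stubDictionary_factorization_S4]
  omega

/-- `rad(n) ∣ S₄(n)` (every exponent `⌈v/4⌉ ≥ 1` when `v ≥ 1`), hence `rad(n) ≤ S₄(n)`. [folklore] -/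
theorem certificates_radical_le_S4 (n : ℕ) :
    radical n ≤ ∏ q ∈ n.primeFactors, q ^ ((n.factorization q + 3) / 4) := by
  rcases eq_or_ne n 0 with rfl | hn
  · simp [UniqueFactorizationMonoid.radical_zero]
  refine Nat.le_of_dvd (certificates_S4_pos n) ?_
  rw [← Nat.factorization_le_iff_dvd (Nat.radical_pos n).ne' (certificates_S4_pos n).ne']
  intro p
  rw [stubDictionary_factorization_S4, Nat.radical_eq_prod_primeFactors,
    Nat.factorization_prod fun q hq => (Nat.prime_of_mem_primeFactors hq).ne_zero]
  simp only [Finsupp.coe_finsetSum, Finset.sum_apply]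
  by_cases hp : p ∈ n.primeFactors
  · rw [Finset.sum_eq_single p (fun q hq hqp => by
        rw [Nat.Prime.factorization (Nat.prime_of_mem_primeFactors hq), Finsupp.single_apply, if_neg hqp])
        (fun h => (h hp).elim), Nat.Prime.factorization (Nat.prime_of_mem_primeFactors hp),
      Finsupp.single_eq_same]
    have h1 : 1 ≤ n.factorization p := by
      rw [← Nat.support_factorization, Finsupp.mem_support_iff] at hp
      omega
    omega
  · rw [Finset.sum_eq_zero fun q hq => by
        rw [Nat.Prime.factorization (Nat.prime_of_mem_primeFactors hq), Finsupp.single_apply, if_neg]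
        rintro rfl; exact hp hq]
    exact Nat.zero_le _

/-- Monotonicity and sub-multiplicativity of `S₄` along a weighted product, in the form the converse
dictionary needs: if `N ∣ ∏_{j<4} P_j^(j+1)` with all `P_j ≥ 1`, then `S₄(N) ∣ ∏_j P_j`
(`⌈v_p(N)/4⌉ ≤ ⌈(Σ_j (j+1) v_p(P_j))/4⌉ ≤ Σ_j v_p(P_j)`). [folklore] -/
theorem certificates_S4_dvd_prod_of_dvd {N : ℕ} {P : Fin 4 → ℕ} (hP : ∀ j, 0 < P j)
    (hN : N ∣ ∏ j, P j ^ (j.val + 1)) :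
    (∏ q ∈ N.primeFactors, q ^ ((N.factorization q + 3) / 4)) ∣ ∏ j, P j := by
  have hA : (∏ j, P j ^ (j.val + 1)) ≠ 0 := (Finset.prod_pos fun j _ => pow_pos (hP j) _).ne'
  have hN0 : N ≠ 0 := by rintro rfl; exact hA (zero_dvd_iff.mp hN)
  have hB : (∏ j, P j) ≠ 0 := (Finset.prod_pos fun j _ => hP j).ne'
  rw [← Nat.factorization_le_iff_dvd (certificates_S4_pos N).ne' hB]
  intro p
  rw [stubDictionary_factorization_S4]
  have h1 : N.factorization p ≤ (∏ j, P j ^ (j.val + 1)).factorization p :=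
    (Nat.factorization_le_iff_dvd hN0 hA).mpr hN p
  rw [Nat.factorization_prod fun j _ => pow_ne_zero _ (hP j).ne'] at h1
  rw [Nat.factorization_prod fun j _ => (hP j).ne']
  simp only [Finsupp.coe_finsetSum, Finset.sum_apply, Nat.factorization_pow, Finsupp.smul_apply,
    smul_eq_mul] at h1 ⊢
  have h2 : ∑ j : Fin 4, (j.val + 1) * (P j).factorization p ≤ 4 * ∑ j : Fin 4, (P j).factorization p := by
    rw [Finset.mul_sum]
    exact Finset.sum_le_sum fun j _ => Nat.mul_le_mul_right _ (by have := j.isLt; omega)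
  omega

/-! ## The converse dictionary `S4SmallMemberABC → LW4` -/

/-- A positive rational is its numerator over its denominator, with natural-number numerator
`|num|`: `(x : ℝ) = |num x| / den x` for `0 < x`. [folklore] -/
theorem certificates_cast_eq_natAbs_div {x : ℚ} (hx : 0 < x) :
    ((x : ℚ) : ℝ) = ((x.num.natAbs : ℕ) : ℝ) / ((x.den : ℕ) : ℝ) := by
  have hnum : ((x.num.natAbs : ℕ) : ℤ) = x.num := Int.natAbs_of_nonneg (Rat.num_nonneg.mpr hx.le)
  have h : ((x.num.natAbs : ℕ) : ℝ) = (x.num : ℝ) := by rw [← Int.cast_natCast, hnum]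
  rw [Rat.cast_def, h]

/-- For positive `x : Fin 4 → ℚ` the linear form is the logarithm of the weighted product read through
numerators and denominators: `Σ (j+1) log x_j = log (∏ |num x_j|^(j+1)) − log (∏ (den x_j)^(j+1))`. [folklore] -/
theorem certificates_form_eq_log_sub (x : Fin 4 → ℚ) (hx : ∀ j, 0 < x j) :
    (∑ j : Fin 4, ((j.val : ℝ) + 1) * Real.log ((x j : ℚ) : ℝ)) =
      Real.log ((∏ j : Fin 4, (x j).num.natAbs ^ (j.val + 1) : ℕ) : ℝ) -
        Real.log ((∏ j : Fin 4, (x j).den ^ (j.val + 1) : ℕ) : ℝ) := by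
  have hnum0 : ∀ j, 0 < (x j).num.natAbs := fun j =>
    Int.natAbs_pos.mpr (Rat.num_pos.mpr (hx j)).ne'
  rw [stubDictionary_log_lift (fun j => (x j).num.natAbs) hnum0,
    stubDictionary_log_lift (fun j => (x j).den) fun j => (x j).den_pos, ← Finset.sum_sub_distrib]
  refine Finset.sum_congr rfl fun j _ => ?_
  rw [certificates_cast_eq_natAbs_div (hx j),
    Real.log_div (by exact_mod_cast (hnum0 j).ne') (by exact_mod_cast (x j).den_pos.ne')]
  ring

/-- `log` of a ratio of naturals dominates the relative gap: for `0 < D < N`,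
`(N − D)/N ≤ log N − log D`. [folklore] -/
theorem certificates_gap_le_log {N D : ℕ} (hD : 0 < D) (hDN : D < N) :
    ((N - D : ℕ) : ℝ) / N ≤ Real.log N - Real.log D := by
  have hN : 0 < N := hD.trans hDN
  have hNR : (0 : ℝ) < N := by exact_mod_cast hN
  have hDR : (0 : ℝ) < D := by exact_mod_cast hD
  rw [Nat.cast_sub hDN.le, ← Real.log_div hNR.ne' hDR.ne']
  calc ((N : ℝ) - D) / N = 1 - ((N : ℝ) / D)⁻¹ := by rw [inv_div]; field_simp
    _ ≤ Real.log ((N : ℝ) / D) := Real.one_sub_inv_le_log_of_pos (div_pos hNR hDR)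

/-- **Converse dictionary `S4SmallMemberABC → LW4`** (card `depth-grouped-four-logarithms`, item L1, converse
direction), fully unfolded.  Given `x ∈ ℚ_{>0}⁴` with nonzero form, write `A = ∏ |num x_j|^(j+1)`,
`B = ∏ (den x_j)^(j+1)`; then `Λ(x) = log A − log B`, so `A ≠ B`; with `g = gcd(A, B)`, `N = A/g`, `D = B/g` the
triple `(|N − D|, min(N,D), max(N,D))` is abc, `S₄(N)·S₄(D) ≤ ∏ |num x_j| · ∏ den x_j = H(x)`
(`certificates_S4_dvd_prod_of_dvd`), `|Λ(x)| = |log N − log D| ≥ |N − D|/max(N, D)`, and the hypothesis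
`max ≤ C·|N−D|·(S₄S₄)^(1+ε)` gives `|Λ(x)| ≥ C⁻¹·H(x)^(−(1+ε))`. [folklore] -/
theorem lw4_of_s4SmallMember :
    (∀ ε : ℝ, 0 < ε → ∃ C : ℝ, 0 < C ∧ ∀ a b c : ℕ,
      Literature.NumberTheory.DiophantineGeometry.IsABCTriple a b c →
      (c : ℝ) ≤ C * (a : ℝ) *
        (((∏ p ∈ b.primeFactors, p ^ ((b.factorization p + 3) / 4)) *
          (∏ p ∈ c.primeFactors, p ^ ((c.factorization p + 3) / 4)) : ℕ) : ℝ) ^ (1 + ε)) →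
    ∀ ε : ℝ, 0 < ε → ∃ C : ℝ, 0 < C ∧ ∀ x : Fin 4 → ℚ, (∀ j, 0 < x j) →
      (∑ j : Fin 4, ((j.val : ℝ) + 1) * Real.log ((x j : ℚ) : ℝ)) ≠ 0 →
      C⁻¹ * ((∏ j : Fin 4, (x j).num.natAbs * (x j).den : ℕ) : ℝ) ^ (-(1 + ε)) ≤
        |∑ j : Fin 4, ((j.val : ℝ) + 1) * Real.log ((x j : ℚ) : ℝ)| := by
  intro hS ε hε
  obtain ⟨C, hC, hSC⟩ := hS ε hε
  refine ⟨C, hC, fun x hx hne => ?_⟩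
  -- numerators / denominators
  set P : Fin 4 → ℕ := fun j => (x j).num.natAbs with hPdef
  set Q : Fin 4 → ℕ := fun j => (x j).den with hQdef
  have hP0 : ∀ j, 0 < P j := fun j => Int.natAbs_pos.mpr (Rat.num_pos.mpr (hx j)).ne'
  have hQ0 : ∀ j, 0 < Q j := fun j => (x j).den_pos
  set A : ℕ := ∏ j, P j ^ (j.val + 1) with hAdef
  set B : ℕ := ∏ j, Q j ^ (j.val + 1) with hBdef
  have hA0 : 0 < A := Finset.prod_pos fun j _ => pow_pos (hP0 j) _
  have hB0 : 0 < B := Finset.prod_pos fun j _ => pow_pos (hQ0 j) _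
  have hΛ : (∑ j : Fin 4, ((j.val : ℝ) + 1) * Real.log ((x j : ℚ) : ℝ)) = Real.log A - Real.log B :=
    certificates_form_eq_log_sub x hx
  -- reduce `A / B`
  set g : ℕ := Nat.gcd A B with hgdef
  have hg0 : 0 < g := Nat.gcd_pos_of_pos_left B hA0
  obtain ⟨N, hAN⟩ : g ∣ A := Nat.gcd_dvd_left A B
  obtain ⟨D, hBD⟩ : g ∣ B := Nat.gcd_dvd_right A B
  have hN0 : 0 < N := by
    rcases Nat.eq_zero_or_pos N with h | h
    · rw [h, mul_zero] at hAN; omega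
    · exact h
  have hD0 : 0 < D := by
    rcases Nat.eq_zero_or_pos D with h | h
    · rw [h, mul_zero] at hBD; omega
    · exact h
  have hcopND : Nat.Coprime N D := by
    have h := Nat.coprime_div_gcd_div_gcd (m := A) (n := B) hg0
    rw [← hgdef] at h
    have h1 : A / g = N := by rw [hAN, Nat.mul_div_cancel_left N hg0]
    have h2 : B / g = D := by rw [hBD, Nat.mul_div_cancel_left D hg0]
    rwa [h1, h2] at h
  have hNA : N ∣ A := ⟨g, by rw [hAN, mul_comm]⟩
  have hDB : D ∣ B := ⟨g, by rw [hBD, mul_comm]⟩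
  -- `log A - log B = log N - log D`
  have hgR : (0 : ℝ) < g := by exact_mod_cast hg0
  have hNR : (0 : ℝ) < N := by exact_mod_cast hN0
  have hDR : (0 : ℝ) < D := by exact_mod_cast hD0
  have hΛ' : Real.log A - Real.log B = Real.log N - Real.log D := by
    rw [hAN, hBD, Nat.cast_mul, Nat.cast_mul, Real.log_mul hgR.ne' hNR.ne', Real.log_mul hgR.ne' hDR.ne']
    ring
  rw [hΛ, hΛ'] at hne ⊢
  have hND : N ≠ D := by
    rintro rfl; exact hne (sub_self _)
  -- the height dominates `S₄(N) · S₄(D)`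
  set SN : ℕ := ∏ q ∈ N.primeFactors, q ^ ((N.factorization q + 3) / 4) with hSNdef
  set SD : ℕ := ∏ q ∈ D.primeFactors, q ^ ((D.factorization q + 3) / 4) with hSDdef
  have hSN : SN ∣ ∏ j, P j := certificates_S4_dvd_prod_of_dvd hP0 hNA
  have hSD : SD ∣ ∏ j, Q j := certificates_S4_dvd_prod_of_dvd hQ0 hDB
  have hH : (∏ j : Fin 4, (x j).num.natAbs * (x j).den) = (∏ j, P j) * ∏ j, Q j := by
    rw [← Finset.prod_mul_distrib]
  have hSH : SD * SN ≤ ∏ j : Fin 4, (x j).num.natAbs * (x j).den := by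
    rw [hH, mul_comm]
    exact Nat.le_of_dvd (mul_pos (Finset.prod_pos fun j _ => hP0 j) (Finset.prod_pos fun j _ => hQ0 j))
      (mul_dvd_mul hSN hSD)
  have hSpos : 0 < SD * SN := mul_pos (certificates_S4_pos D) (certificates_S4_pos N)
  -- real bookkeeping common to both orderings
  set H : ℕ := ∏ j : Fin 4, (x j).num.natAbs * (x j).den with hHdef
  have hHR : (0 : ℝ) < (H : ℝ) := by exact_mod_cast hSpos.trans_le hSH
  have hSR : (0 : ℝ) < ((SD * SN : ℕ) : ℝ) := by exact_mod_cast hSpos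
  have hpow : ((SD * SN : ℕ) : ℝ) ^ (1 + ε) ≤ (H : ℝ) ^ (1 + ε) :=
    Real.rpow_le_rpow hSR.le (by exact_mod_cast hSH) (by linarith)
  have hTpos : (0 : ℝ) < ((SD * SN : ℕ) : ℝ) ^ (1 + ε) := Real.rpow_pos_of_pos hSR _
  -- `C⁻¹ · H^(−(1+ε)) ≤ C⁻¹ · (SD·SN)^(−(1+ε))`, and the latter is `≤ gap/max` by the hypothesis
  have hstep : C⁻¹ * (H : ℝ) ^ (-(1 + ε)) ≤ C⁻¹ * ((SD * SN : ℕ) : ℝ) ^ (-(1 + ε)) := by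
    rw [Real.rpow_neg hHR.le, Real.rpow_neg hSR.le]
    exact mul_le_mul_of_nonneg_left (inv_anti₀ hTpos hpow) (inv_pos.mpr hC).le
  refine hstep.trans ?_
  rcases lt_or_gt_of_ne hND with hlt | hgt
  · -- `N < D`: the abc triple `(D - N, N, D)`, `|Λ| = log D - log N`
    have habc : Literature.NumberTheory.DiophantineGeometry.IsABCTriple (D - N) N D :=
      ⟨Nat.sub_pos_of_lt hlt, hN0, Nat.sub_add_cancel hlt.le,
        (Nat.coprime_sub_self_left hlt.le).mpr hcopND.symm⟩
    have key := hSC (D - N) N D habc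
    -- `key : D ≤ C * (D - N) * (SN * SD)^(1+ε)`
    rw [abs_of_neg (sub_neg.mpr (Real.log_lt_log hNR (by exact_mod_cast hlt)))]
    rw [neg_sub]
    refine le_trans ?_ (certificates_gap_le_log hN0 hlt)
    rw [mul_comm SN SD] at key
    rw [Real.rpow_neg hSR.le, ← mul_inv, inv_eq_one_div, div_le_div_iff₀ (mul_pos hC hTpos) hDR, one_mul]
    calc (D : ℝ) ≤ C * ((D - N : ℕ) : ℝ) * ((SD * SN : ℕ) : ℝ) ^ (1 + ε) := key
      _ = ((D - N : ℕ) : ℝ) * (C * ((SD * SN : ℕ) : ℝ) ^ (1 + ε)) := by ring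
  · -- `D < N`: the abc triple `(N - D, D, N)`, `|Λ| = log N - log D`
    have habc : Literature.NumberTheory.DiophantineGeometry.IsABCTriple (N - D) D N :=
      ⟨Nat.sub_pos_of_lt hgt, hD0, Nat.sub_add_cancel hgt.le,
        (Nat.coprime_sub_self_left hgt.le).mpr hcopND⟩
    have key := hSC (N - D) D N habc
    -- `key : N ≤ C * (N - D) * (SD * SN)^(1+ε)`
    rw [abs_of_pos (sub_pos.mpr (Real.log_lt_log hDR (by exact_mod_cast hgt)))]
    refine le_trans ?_ (certificates_gap_le_log hD0 hgt)
    rw [Real.rpow_neg hSR.le, ← mul_inv, inv_eq_one_div, div_le_div_iff₀ (mul_pos hC hTpos) hNR, one_mul]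
    calc (N : ℝ) ≤ C * ((N - D : ℕ) : ℝ) * ((SD * SN : ℕ) : ℝ) ^ (1 + ε) := key
      _ = ((N - D : ℕ) : ℝ) * (C * ((SD * SN : ℕ) : ℝ) ^ (1 + ε)) := by ring

/-- **`LW4 ↔ S4SmallMemberABC`** (card `depth-grouped-four-logarithms`, item L1, both directions; the forward
direction is the landed stub `stub_dictionary`).  Card 1's C⁺ is therefore EQUIVALENT to an abc-type statement,
not a strengthening in costume. [folklore] -/
theorem lw4_iff_s4SmallMember :
    (∀ ε : ℝ, 0 < ε → ∃ C : ℝ, 0 < C ∧ ∀ x : Fin 4 → ℚ, (∀ j, 0 < x j) →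
      (∑ j : Fin 4, ((j.val : ℝ) + 1) * Real.log ((x j : ℚ) : ℝ)) ≠ 0 →
      C⁻¹ * ((∏ j : Fin 4, (x j).num.natAbs * (x j).den : ℕ) : ℝ) ^ (-(1 + ε)) ≤
        |∑ j : Fin 4, ((j.val : ℝ) + 1) * Real.log ((x j : ℚ) : ℝ)|) ↔
    (∀ ε : ℝ, 0 < ε → ∃ C : ℝ, 0 < C ∧ ∀ a b c : ℕ,
      Literature.NumberTheory.DiophantineGeometry.IsABCTriple a b c →
      (c : ℝ) ≤ C * (a : ℝ) *
        (((∏ p ∈ b.primeFactors, p ^ ((b.factorization p + 3) / 4)) *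
          (∏ p ∈ c.primeFactors, p ^ ((c.factorization p + 3) / 4)) : ℕ) : ℝ) ^ (1 + ε)) :=
  ⟨stub_dictionary, lw4_of_s4SmallMember⟩

/-! ## `ABC → S4SmallMemberABC`, hence `ABC → LW4` -/

/-- **`ABC → S4SmallMemberABC`** (card `depth-grouped-four-logarithms`, item L3), fully unfolded: from abc at
`ε/5`, `c < C·rad(abc)^(1+ε/5) ≤ C·(a·S)^(1+ε/5)` with `S = S₄(b)S₄(c)` (`rad ≤ S₄`, `rad a ≤ a`), and
`a^(ε/5) ≤ c^(ε/5) ≤ S^(4ε/5)` because `c ≤ S₄(c)⁴ ≤ S⁴`. [folklore] -/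
theorem s4SmallMember_of_abc (habc : _root_.ABC) :
    ∀ ε : ℝ, 0 < ε → ∃ C : ℝ, 0 < C ∧ ∀ a b c : ℕ,
      Literature.NumberTheory.DiophantineGeometry.IsABCTriple a b c →
      (c : ℝ) ≤ C * (a : ℝ) *
        (((∏ p ∈ b.primeFactors, p ^ ((b.factorization p + 3) / 4)) *
          (∏ p ∈ c.primeFactors, p ^ ((c.factorization p + 3) / 4)) : ℕ) : ℝ) ^ (1 + ε) := by
  intro ε hε
  obtain ⟨C, hC, hABC⟩ := (ABC_iff.mp habc) (ε / 5) (by linarith)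
  refine ⟨C, hC, fun a b c ht => ?_⟩
  have key := hABC a b c ht
  obtain ⟨ha, hb, hsum, -⟩ := ht
  have hc : 0 < c := by omega
  set Sb : ℕ := ∏ q ∈ b.primeFactors, q ^ ((b.factorization q + 3) / 4) with hSb
  set Sc : ℕ := ∏ q ∈ c.primeFactors, q ^ ((c.factorization q + 3) / 4) with hSc
  have hSb0 : 0 < Sb := certificates_S4_pos b
  have hSc0 : 0 < Sc := certificates_S4_pos c
  -- `rad(abc) ≤ a · (Sb · Sc)` in `ℕ`
  have hrad : Literature.NumberTheory.DiophantineGeometry.rad a b c ≤ a * (Sb * Sc) := by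
    rw [Literature.NumberTheory.DiophantineGeometry.rad_def]
    have h1 : radical (a * b * c) ≤ radical a * radical b * radical c := by
      refine Nat.le_of_dvd (by positivity) ?_
      exact (UniqueFactorizationMonoid.radical_mul_dvd).trans
        (mul_dvd_mul UniqueFactorizationMonoid.radical_mul_dvd (dvd_refl _))
    have h2 : radical a ≤ a := Nat.le_of_dvd ha UniqueFactorizationMonoid.radical_dvd_self
    calc radical (a * b * c) ≤ radical a * radical b * radical c := h1
      _ ≤ a * Sb * Sc := Nat.mul_le_mul (Nat.mul_le_mul h2 (certificates_radical_le_S4 b))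
          (certificates_radical_le_S4 c)
      _ = a * (Sb * Sc) := by ring
  -- `c ≤ (Sb · Sc)⁴`
  have hcS : c ≤ (Sb * Sc) ^ 4 := by
    calc c ≤ Sc ^ 4 := certificates_le_S4_pow_four hc.ne'
      _ ≤ (Sb * Sc) ^ 4 := Nat.pow_le_pow_left (Nat.le_mul_of_pos_left Sc hSb0) 4
  -- reals
  set S : ℝ := ((Sb * Sc : ℕ) : ℝ) with hSdef
  have hS1 : (1 : ℝ) ≤ S := by rw [hSdef]; exact_mod_cast mul_pos hSb0 hSc0
  have hS0 : (0 : ℝ) < S := by linarith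
  have haR : (1 : ℝ) ≤ a := by exact_mod_cast ha
  have ha0 : (0 : ℝ) < a := by linarith
  have hcR : (0 : ℝ) < c := by exact_mod_cast hc
  have hradR : ((Literature.NumberTheory.DiophantineGeometry.rad a b c : ℕ) : ℝ) ≤ (a : ℝ) * S := by
    rw [hSdef]; exact_mod_cast hrad
  have hcSR : (c : ℝ) ≤ S ^ (4 : ℝ) := by
    rw [hSdef, show (4 : ℝ) = (4 : ℕ) by norm_num, Real.rpow_natCast]; exact_mod_cast hcS
  have he : 0 < 1 + ε / 5 := by linarith
  -- `rad^(1+ε/5) ≤ (a S)^(1+ε/5) = a · a^(ε/5) · S^(1+ε/5) ≤ a · S^(4ε/5) · S^(1+ε/5) = a · S^(1+ε)`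
  have h1 : ((Literature.NumberTheory.DiophantineGeometry.rad a b c : ℕ) : ℝ) ^ (1 + ε / 5) ≤
      ((a : ℝ) * S) ^ (1 + ε / 5) :=
    Real.rpow_le_rpow (Nat.cast_nonneg _) hradR he.le
  have h2 : ((a : ℝ) * S) ^ (1 + ε / 5) = (a : ℝ) * (a : ℝ) ^ (ε / 5) * S ^ (1 + ε / 5) := by
    rw [Real.mul_rpow ha0.le hS0.le, Real.rpow_add ha0, Real.rpow_one]
  have h3 : (a : ℝ) ^ (ε / 5) ≤ S ^ (4 * (ε / 5)) := by
    have hac : (a : ℝ) ≤ c := by exact_mod_cast (show a ≤ c by omega)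
    calc (a : ℝ) ^ (ε / 5) ≤ (c : ℝ) ^ (ε / 5) := Real.rpow_le_rpow ha0.le hac (by linarith)
      _ ≤ (S ^ (4 : ℝ)) ^ (ε / 5) := Real.rpow_le_rpow hcR.le hcSR (by linarith)
      _ = S ^ (4 * (ε / 5)) := by rw [← Real.rpow_mul hS0.le]
  have h4 : (a : ℝ) * (a : ℝ) ^ (ε / 5) * S ^ (1 + ε / 5) ≤ (a : ℝ) * S ^ (1 + ε) := by
    have hS15 : (0 : ℝ) ≤ S ^ (1 + ε / 5) := (Real.rpow_pos_of_pos hS0 _).le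
    calc (a : ℝ) * (a : ℝ) ^ (ε / 5) * S ^ (1 + ε / 5)
        ≤ (a : ℝ) * S ^ (4 * (ε / 5)) * S ^ (1 + ε / 5) :=
          mul_le_mul_of_nonneg_right (mul_le_mul_of_nonneg_left h3 ha0.le) hS15
      _ = (a : ℝ) * S ^ (1 + ε) := by
          rw [mul_assoc, ← Real.rpow_add hS0]; ring_nf
  calc (c : ℝ) ≤ C * ((Literature.NumberTheory.DiophantineGeometry.rad a b c : ℕ) : ℝ) ^ (1 + ε / 5) :=
        key.le
    _ ≤ C * ((a : ℝ) * S ^ (1 + ε)) := by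
        refine mul_le_mul_of_nonneg_left ?_ hC.le
        exact h1.trans (h2.le.trans h4)
    _ = C * (a : ℝ) * S ^ (1 + ε) := by ring

/-- **`ABC → LW4`**: the summit implies card 1's C⁺ (so `stub_LW4` of line `Sketch` is not refutable short of
`¬ABC`). [folklore] -/
theorem lw4_of_abc (habc : _root_.ABC) :
    ∀ ε : ℝ, 0 < ε → ∃ C : ℝ, 0 < C ∧ ∀ x : Fin 4 → ℚ, (∀ j, 0 < x j) →
      (∑ j : Fin 4, ((j.val : ℝ) + 1) * Real.log ((x j : ℚ) : ℝ)) ≠ 0 →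
      C⁻¹ * ((∏ j : Fin 4, (x j).num.natAbs * (x j).den : ℕ) : ℝ) ^ (-(1 + ε)) ≤
        |∑ j : Fin 4, ((j.val : ℝ) + 1) * Real.log ((x j : ℚ) : ℝ)| :=
  lw4_of_s4SmallMember (s4SmallMember_of_abc habc)

/-! ## Registered certificate stubs of the crux item (stmt-ABC-14938), by name and signature -/

/-- **Registered certificate `stub_lw4IffS4SmallMember`** (= `lw4_iff_s4SmallMember`): card 1's C⁺ `LW4` is
EQUIVALENT to the abc-type statement `S4SmallMemberABC`. [folklore] -/
theorem stub_lw4IffS4SmallMember : (∀ ε : ℝ, 0 < ε → ∃ C : ℝ, 0 < C ∧ ∀ x : Fin 4 → ℚ, (∀ j, 0 < x j) → (∑ j : Fin 4, ((j.val : ℝ) + 1) * Real.log ((x j : ℚ) : ℝ)) ≠ 0 → C⁻¹ * ((∏ j : Fin 4, (x j).num.natAbs * (x j).den : ℕ) : ℝ) ^ (-(1 + ε)) ≤ |∑ j : Fin 4, ((j.val : ℝ) + 1) * Real.log ((x j : ℚ) : ℝ)|) ↔ (∀ ε : ℝ, 0 < ε → ∃ C : ℝ, 0 < C ∧ ∀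 a b c : ℕ, Literature.NumberTheory.DiophantineGeometry.IsABCTriple a b c → (c : ℝ) ≤ C * (a : ℝ) * (((∏ p ∈ b.primeFactors, p ^ ((b.factorization p + 3) / 4)) * (∏ p ∈ c.primeFactors, p ^ ((c.factorization p + 3) / 4)) : ℕ) : ℝ) ^ (1 + ε)) :=
  lw4_iff_s4SmallMember

/-- **Registered certificate `stub_lw4OfAbc`** (= `lw4_of_abc`): the summit implies `LW4`. [folklore] -/
theorem stub_lw4OfAbc : _root_.ABC → ∀ ε : ℝ, 0 < ε → ∃ C : ℝ, 0 < C ∧ ∀ x : Fin 4 → ℚ, (∀ j, 0 < x j) → (∑ j : Fin 4, ((j.val : ℝ) + 1) * Real.log ((x j : ℚ) : ℝ)) ≠ 0 → C⁻¹ * ((∏ j : Fin 4, (x j).num.natAbs * (x j).den : ℕ) : ℝ) ^ (-(1 + ε)) ≤ |∑ j : Fin 4, ((j.val : ℝ) + 1) * Real.log ((x j : ℚ) : ℝ)| :=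
  lw4_of_abc

end Summit.ABC.ABC.Theorems.DepthCountedABC
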